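import Summits.BirchSwinnertonDyer.BirchSwinnertonDyer.Theorems.ThetaPartnerAtTwoSignedKatoUpToAtTwoLayerPairingModDefs
import Summits.BirchSwinnertonDyer.BirchSwinnertonDyer.Theorems.ThetaPartnerAtTwoSignedKatoUpToAtTwoLayerPairingLimit
import Literature.NumberTheory.EllipticCurves.Kato2004.IwasawaH1ReductionPkSemilinear
import HarnessLib

/-!
# Route `ThetaPartnerAtTwo` (TP2), crux K3 `SignedKatoDivisibilityUpToAtTwo` (item stmt-BirchSwinnertonDyer-20308),
# line `colemanrat` v7 — (D-layer) from `T_pW`: the layer pairings `pk n k : H¹(Γ_n, T_pW) → Hom(E(ℚ_{n,v}), ℤ/p^k)`,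
# (P1_k)/(P2_k), `ℤ_p`-semilinearity, and the `ℤ_p`-LINEAR glue `∃ pair` with (P1)(P2) modulo the level compatibility

Width seat `bsd-wall-tp2-p2x-w3` g4 (cell `bsd-wall`). Definition with body (`layerPairingPk`)
and theorems; no named fact, no instance, no `sorry`; closes no item; BSD is NOT proved by any of this.

## What is here

On top of `…LayerPairingModDefs.lean` (the finite-coefficient layer pairing `layerPairingMod … N … n` with (P1)/(P2)
modulo `N`) and w2's `…LayerPairingLimit.lean` (the `k`-glue):

* §1–§2 the tree's reduction `Kato2004.reduceH1Pk W p k U : H¹(U, T_pW) →+ H¹(U, E[p^k])` (index `geomTorsion W ((p : ℤ) ^ k)`,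
  definitionally the `ℕ`-cast index `geomTorsion W ((p ^ k : ℕ) : ℤ)` of the Weil-pairing / `μ_N` files, so `layerPairingMod (p^k)`
  composes with it; `ℤ_p`-semilinearity `Kato2004.reduceH1Pk_smul_nat`) and `layerPairingPk … n k = layerPairingMod (p^k) ∘ reduceH1Pk` for a family of Weil pairing data `ePk k` on `E[p^k]`, with
  **`layerPairingPk_layerCores`** (P1_k), **`layerPairingPk_conjMap`** (P2_k), **`layerPairingPk_smul`** (`ℤ_p`-semilinear);
* §3 **`exists_linear_layerPairing_of_compatible`**: IF the `layerPairingPk` are compatible under `ℤ/p^{k+1} → ℤ/p^k` THEN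
  `∃ pair : ∀ n, H¹(Γ_n, T_pW) →ₗ[ℤ_p] (E(ℚ_{n,v}) →+ ℤ_p)` with residues `layerPairingPk` and with (P1), (P2) in EXACTLY the
  form of the hypotheses of `SignedKatoOffTwo.ColGlue.exists_col_linear` (w2) = the (D-layer) clause of
  `Cruxes.SignedKatoDivisibilityUpToAtTwo.ColemanRat.stub_layerSideTwoInv` (the stub asks (P2) for one local lift `g`; here
  for every `g ∈ Γ_v`).  The remaining input — the level compatibility — is Silverman AEC III.8.1(e)
  (`e_{p^{k+1}}(S,T)^p = e_{p^k}(pS, pT)`, not yet in the tree for `weilPairingFun`) + the level change of THE invariant maps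
  (`LocalInvariantMapLevelChange`) + the coefficient naturality of Kummer/Shapiro/`coindFin` (all elementary).

References: [Kobayashi2003] (8.23) (p. 18); [PerrinRiou1994Invent] §3.6.1; [Kato2004Asterisque] §12.2, §13.8; [SilvermanAEC2009]
III.8.1.
-/

set_option autoImplicit false
-- the Theorems namespace of this sub repeats the summit name by design (D-0017 nested layout)
set_option linter.dupNamespace false

noncomputable section

open scoped Classical

namespace Summit.BirchSwinnertonDyer.BirchSwinnertonDyer.Theorems

namespace SignedKatoOffTwo.LayerPairing

open CategoryTheory Field NumberField IsDedekindDomain WeierstrassCurve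
  Literature.NumberTheory.EllipticCurves Literature.NumberTheory.GaloisRepresentations
  Literature.NumberTheory.EllipticCurves.Kobayashi2003 Literature.NumberTheory.EllipticCurves.Sprung2012
  Literature.NumberTheory.GaloisCohomology ZpExtension

attribute [local instance] absoluteGaloisGroup_compactSpace

variable (W : WeierstrassCurve ℚ) [W.IsElliptic] {p : ℕ} [Fact p.Prime] (κ : ZpExtension ℚ p) (v : HeightOneSpectrum (𝓞 ℚ))

attribute [local instance] finite_geomTorsion_of_neZero

/-! ## §1–§2 From `T_pW`: reduction modulo `p^k`, the layer pairings `pk n k`, (P1_k)/(P2_k), `ℤ_p`-semilinearity -/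

section TateModule

open Literature.NumberTheory.EllipticCurves.Kato2004 Literature.NumberTheory.EllipticCurves.Kato2004.EulerSystemValues

variable [ContinuousSMul ℤ_[p] (W.tateModule p)] (k : ℕ)


variable (ePk : ∀ k : ℕ, geomTorsion W (p ^ k) → geomTorsion W (p ^ k) → AlgebraicClosure ℚ)
  (hμPk : ∀ k S T, ePk k S T ^ (p ^ k) = 1)
  (hadd₁Pk : ∀ k S₁ S₂ T, ePk k (S₁ + S₂) T = ePk k S₁ T * ePk k S₂ T)
  (hadd₂Pk : ∀ k S T₁ T₂, ePk k S (T₁ + T₂) = ePk k S T₁ * ePk k S T₂)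
  (hgalPk : ∀ k (σ : absoluteGaloisGroup ℚ) (S T : geomTorsion W (p ^ k)), σ • ePk k S T = ePk k (σ • S) (σ • T))

/-- **The layer pairings on `𝐇¹`-classes**: `pk n k : H¹(Γ_n, T_pW) →+ (E(ℚ_{n,v}) →+ ℤ/p^k)`,
`x ↦ ⟨red_{p^k} x, ·⟩_{n,p^k}` (`red_{p^k}` = the tree's `Kato2004.reduceH1Pk`) — the family to which w2's
`LayerPairingLimit.exists_linear_pairing_of_compatible` applies. [cite: Kobayashi2003, (8.23) (p. 18)] [cite: PerrinRiou1994Invent, §3.6.1]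
[cite: Kato2004Asterisque, §13.8] -/
def layerPairingPk (n k : ℕ) :
    H1 (tateRep W p) (κ.layerSubgroup n) →+
      (localLayerPointsOfEmb κ (closureEmb (K := ℚ) (v.adicCompletion ℚ)) W n →+ ZMod (p ^ k)) :=
  haveI : NeZero (p ^ k) := ⟨pow_ne_zero k (Fact.out : p.Prime).ne_zero⟩
  (layerPairingMod W (p ^ k) (ePk k) (hμPk k) (hadd₁Pk k) (hadd₂Pk k) (hgalPk k) κ v n).comp
    (reduceH1Pk W p k (κ.layerSubgroup n))

/-- Unfolding `layerPairingPk`. [cite: Kobayashi2003, (8.23) (p. 18)] -/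
theorem layerPairingPk_apply (n k : ℕ) (x : H1 (tateRep W p) (κ.layerSubgroup n)) :
    layerPairingPk W κ v ePk hμPk hadd₁Pk hadd₂Pk hgalPk n k x =
      haveI : NeZero (p ^ k) := ⟨pow_ne_zero k (Fact.out : p.Prime).ne_zero⟩
      layerPairingMod W (p ^ k) (ePk k) (hμPk k) (hadd₁Pk k) (hadd₂Pk k) (hgalPk k) κ v n
        (reduceH1Pk W p k (κ.layerSubgroup n) x) :=
  rfl

variable (hκ : κ.IsCyclotomic) (hv : (p : 𝓞 ℚ) ∈ v.asIdeal)

include hκ hv in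
/-- **(P1_k)**: `pk n k (layerCores x) Q = pk (n+1) k x Q` for `Q ∈ E(ℚ_{n,v})` — the residue-wise projection formula, from
(P1 mod `p^k`) and `reduceH1Pk_layerCores`. [cite: Kobayashi2003, (8.23) (p. 18)] [cite: Kato2004Asterisque, §12.2 (p. 220)] -/
theorem layerPairingPk_layerCores (n k : ℕ) (x : H1 (tateRep W p) (κ.layerSubgroup (n + 1)))
    (Q : localPoints W (v.adicCompletion ℚ))
    (hQ : Q ∈ localLayerPointsOfEmb κ (closureEmb (K := ℚ) (v.adicCompletion ℚ)) W n) :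
    layerPairingPk W κ v ePk hμPk hadd₁Pk hadd₂Pk hgalPk n k (layerCores (tateRep W p) κ n x) ⟨Q, hQ⟩ =
      layerPairingPk W κ v ePk hμPk hadd₁Pk hadd₂Pk hgalPk (n + 1) k x
        ⟨Q, localLayerPointsOfEmb_mono κ (closureEmb (K := ℚ) (v.adicCompletion ℚ)) W (Nat.le_succ n) hQ⟩ := by
  haveI : NeZero (p ^ k) := ⟨pow_ne_zero k (Fact.out : p.Prime).ne_zero⟩
  rw [layerPairingPk_apply, layerPairingPk_apply, reduceH1Pk_layerCores]
  exact layerPairingMod_layerCores W (p ^ k) (ePk k) (hμPk k) (hadd₁Pk k) (hadd₂Pk k) (hgalPk k) κ v hκ hv n _ Q hQ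

/-- **(P2_k)**: `pk n k (g̃ · y) (g • Q) = pk n k y Q` for `g ∈ Γ_v` — residue-wise Galois invariance, from (P2 mod `p^k`) and
`reduceH1Pk_conjMap`. [cite: Kobayashi2003, (8.23) (p. 18)] -/
theorem layerPairingPk_conjMap (n k : ℕ) (g : absoluteGaloisGroup (v.adicCompletion ℚ))
    (y : H1 (tateRep W p) (κ.layerSubgroup n)) (Q : localPoints W (v.adicCompletion ℚ))
    (hQ : Q ∈ localLayerPointsOfEmb κ (closureEmb (K := ℚ) (v.adicCompletion ℚ)) W n) :
    layerPairingPk W κ v ePk hμPk hadd₁Pk hadd₂Pk hgalPk n k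
        (conjMap (tateRep W p).toTopRep (κ.layerSubgroup n) (resGalOfEmb (closureEmb (K := ℚ) (v.adicCompletion ℚ)) g) 1 y)
        ⟨g • Q, smul_mem_localLayerPointsOfEmb κ (closureEmb (K := ℚ) (v.adicCompletion ℚ)) W n g hQ⟩ =
      layerPairingPk W κ v ePk hμPk hadd₁Pk hadd₂Pk hgalPk n k y ⟨Q, hQ⟩ := by
  haveI : NeZero (p ^ k) := ⟨pow_ne_zero k (Fact.out : p.Prime).ne_zero⟩
  rw [layerPairingPk_apply, layerPairingPk_apply, reduceH1Pk_conjMap]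
  exact layerPairingMod_conjMap W (p ^ k) (ePk k) (hμPk k) (hadd₁Pk k) (hadd₂Pk k) (hgalPk k) κ v n g _ Q hQ

/-- **`ℤ_p`-semilinearity in the class**: `pk n k (c • x) Q = (c mod p^k) · pk n k x Q` — the hypothesis `hlin` of
`LayerPairingLimit.exists_linear_pairing_of_compatible`. [cite: Kato2004Asterisque, §13.8 (pp. 228–229)] -/
theorem layerPairingPk_smul (n k : ℕ) (c : ℤ_[p]) (x : H1 (tateRep W p) (κ.layerSubgroup n))
    (Q : localLayerPointsOfEmb κ (closureEmb (K := ℚ) (v.adicCompletion ℚ)) W n) :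
    layerPairingPk W κ v ePk hμPk hadd₁Pk hadd₂Pk hgalPk n k (c • x) Q =
      PadicInt.toZModPow k c * layerPairingPk W κ v ePk hμPk hadd₁Pk hadd₂Pk hgalPk n k x Q := by
  haveI : NeZero (p ^ k) := ⟨pow_ne_zero k (Fact.out : p.Prime).ne_zero⟩
  rw [layerPairingPk_apply, layerPairingPk_apply, reduceH1Pk_smul_nat]
  -- `red x` lives in `H¹(Γ_n, E[(p : ℤ)^k])`, definitionally `H¹(Γ_n, E[((p^k : ℕ) : ℤ)])`: additivity of `layerPairingMod` there
  have h := map_nsmul (layerPairingMod W (p ^ k) (ePk k) (hμPk k) (hadd₁Pk k) (hadd₂Pk k) (hgalPk k) κ v n)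
    (PadicInt.toZModPow k c).val (reduceH1Pk W p k (κ.layerSubgroup n) x)
  erw [h, AddMonoidHom.nsmul_apply, nsmul_eq_mul, ZMod.natCast_zmod_val]
  rfl

end TateModule

/-! ## §3 The `ℤ_p`-valued layer pairings: `∃ pair` with (P1), (P2) — modulo the level compatibility -/

section Limit

open Literature.NumberTheory.EllipticCurves.Kato2004 Literature.NumberTheory.EllipticCurves.Kato2004.EulerSystemValues

variable [ContinuousSMul ℤ_[p] (W.tateModule p)]
  (ePk : ∀ k : ℕ, geomTorsion W (p ^ k) → geomTorsion W (p ^ k) → AlgebraicClosure ℚ)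
  (hμPk : ∀ k S T, ePk k S T ^ (p ^ k) = 1)
  (hadd₁Pk : ∀ k S₁ S₂ T, ePk k (S₁ + S₂) T = ePk k S₁ T * ePk k S₂ T)
  (hadd₂Pk : ∀ k S T₁ T₂, ePk k S (T₁ + T₂) = ePk k S T₁ * ePk k S T₂)
  (hgalPk : ∀ k (σ : absoluteGaloisGroup ℚ) (S T : geomTorsion W (p ^ k)), σ • ePk k S T = ePk k (σ • S) (σ • T))
  (hκ : κ.IsCyclotomic) (hv : (p : 𝓞 ℚ) ∈ v.asIdeal)

include hκ hv in
/-- **The `T_pE`-adic local Tate pairing LAYER BY LAYER, with (P1) and (P2) — modulo the level compatibility of the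
finite pairings.** If the layer pairings `pk n k = ⟨red_{p^k} ·, κ_{U_n}(·)⟩_{n,p^k}` are compatible under
`ℤ/p^{k+1} → ℤ/p^k` (the one remaining input: Silverman AEC III.8.1(e) compatibility `e_{p^{k+1}}(S,T)^p = e_{p^k}(pS,pT)`
of the Weil pairings `ePk` + the level change of the invariant maps), then there are `ℤ_p`-LINEAR layer pairings
`pair n : H¹(Γ_n, T_pW) →ₗ[ℤ_p] (E(ℚ_{n,v}) →+ ℤ_p)` with residues `pk n k` (`toZModPow k (pair n x Q) = pk n k x Q`)
satisfying the projection formula (P1) `pair n (layerCores x) Q = pair (n+1) x Q` and the Galois invariance (P2)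
`pair n (g̃ · y) (g • Q) = pair n y Q` for every `g ∈ Γ_v` — EXACTLY the hypotheses of
`SignedKatoOffTwo.ColGlue.exists_col_linear` (for any local lift `g` of `γ`), i.e. of the (D-layer) clause of the
research stub `stub_layerSideTwoInv`. Glue: `LayerPairingLimit.exists_linear_pairing_of_compatible` (w2) with
`layerPairingPk_smul`; (P1)/(P2) residue-wise from `layerPairingPk_layerCores`/`layerPairingPk_conjMap`.
[cite: Kobayashi2003, (8.23) (p. 18)] [cite: PerrinRiou1994Invent, §3.6.1] [cite: Kato2004Asterisque, §13.8 (pp. 228–229)] -/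
theorem exists_linear_layerPairing_of_compatible
    (hcompat : ∀ (n k : ℕ) (x : H1 (tateRep W p) (κ.layerSubgroup n))
      (Q : localLayerPointsOfEmb κ (closureEmb (K := ℚ) (v.adicCompletion ℚ)) W n),
      (ZMod.cast (layerPairingPk W κ v ePk hμPk hadd₁Pk hadd₂Pk hgalPk n (k + 1) x Q) : ZMod (p ^ k)) =
        layerPairingPk W κ v ePk hμPk hadd₁Pk hadd₂Pk hgalPk n k x Q) :
    ∃ pair : ∀ n : ℕ, H1 (tateRep W p) (κ.layerSubgroup n) →ₗ[ℤ_[p]]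
        (localLayerPointsOfEmb κ (closureEmb (K := ℚ) (v.adicCompletion ℚ)) W n →+ ℤ_[p]),
      (∀ (n k : ℕ) (x : H1 (tateRep W p) (κ.layerSubgroup n))
          (Q : localLayerPointsOfEmb κ (closureEmb (K := ℚ) (v.adicCompletion ℚ)) W n),
          PadicInt.toZModPow k (pair n x Q) = layerPairingPk W κ v ePk hμPk hadd₁Pk hadd₂Pk hgalPk n k x Q) ∧
      (∀ (n : ℕ) (x : H1 (tateRep W p) (κ.layerSubgroup (n + 1))) (Q : localPoints W (v.adicCompletion ℚ))
          (hQ : Q ∈ localLayerPointsOfEmb κ (closureEmb (K := ℚ) (v.adicCompletion ℚ)) W n),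
          pair n (layerCores (tateRep W p) κ n x) ⟨Q, hQ⟩ =
            pair (n + 1) x ⟨Q, localLayerPointsOfEmb_mono κ (closureEmb (K := ℚ) (v.adicCompletion ℚ)) W
              (Nat.le_succ n) hQ⟩) ∧
      (∀ (n : ℕ) (g : absoluteGaloisGroup (v.adicCompletion ℚ)) (y : H1 (tateRep W p) (κ.layerSubgroup n))
          (Q : localPoints W (v.adicCompletion ℚ))
          (hQ : Q ∈ localLayerPointsOfEmb κ (closureEmb (K := ℚ) (v.adicCompletion ℚ)) W n),
          pair n (conjMap (tateRep W p).toTopRep (κ.layerSubgroup n)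
              (resGalOfEmb (closureEmb (K := ℚ) (v.adicCompletion ℚ)) g) 1 y)
            ⟨g • Q, smul_mem_localLayerPointsOfEmb κ (closureEmb (K := ℚ) (v.adicCompletion ℚ)) W n g hQ⟩ =
          pair n y ⟨Q, hQ⟩) := by
  have hex : ∀ n : ℕ, ∃ pair : H1 (tateRep W p) (κ.layerSubgroup n) →ₗ[ℤ_[p]]
      (localLayerPointsOfEmb κ (closureEmb (K := ℚ) (v.adicCompletion ℚ)) W n →+ ℤ_[p]),
      ∀ (k : ℕ) (x : H1 (tateRep W p) (κ.layerSubgroup n))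
        (Q : localLayerPointsOfEmb κ (closureEmb (K := ℚ) (v.adicCompletion ℚ)) W n),
        PadicInt.toZModPow k (pair x Q) = layerPairingPk W κ v ePk hμPk hadd₁Pk hadd₂Pk hgalPk n k x Q := fun n =>
    LayerPairingLimit.exists_linear_pairing_of_compatible (fun k => layerPairingPk W κ v ePk hμPk hadd₁Pk hadd₂Pk hgalPk n k)
      (hcompat n) (fun k c x Q => layerPairingPk_smul W κ v ePk hμPk hadd₁Pk hadd₂Pk hgalPk n k c x Q)
  choose pair hpair using hex
  refine ⟨pair, hpair, fun n x Q hQ => ?_, fun n g y Q hQ => ?_⟩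
  · exact LayerPairingLimit.eq_of_forall_toZModPow_eq fun k => by
      rw [hpair, hpair, layerPairingPk_layerCores W κ v ePk hμPk hadd₁Pk hadd₂Pk hgalPk hκ hv]
  · exact LayerPairingLimit.eq_of_forall_toZModPow_eq fun k => by
      rw [hpair, hpair, layerPairingPk_conjMap]

end Limit

end SignedKatoOffTwo.LayerPairing

end Summit.BirchSwinnertonDyer.BirchSwinnertonDyer.Theorems

end
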